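import Mathlib
import HarnessLib

/-!
# Connectivity correlation inequalities for `φ_{w,q}`, `0 < q ≤ 1` — the THREE-APEX MONOID of `K_{1,1,1,n}`:
# exact-partition vectors, the letter maps, the MASTER inequality and the LOWER ENVELOPE

Helper file (`--supports stmt-CriticalPhenomena-4575`), FK sub-lane `prim-bschramm-fk-3` (gen 12); builds on p205010 (kernel theorem,
internal audit signed; external expert review pending).  Pure real algebra: no measures, no named facts, no sorries; standard axioms.
Layer 1 of the programme "every graph with a vertex cover of size `≤ 3` (`⊆ K_{1,1,1,n} = K₃ + E_n`) is Potts–Rayleigh for `0 < q ≤ 1`", which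
by Dirac–Lovász (3-connected graphs without two disjoint cycles are wheels, `K₅`, `K(3,p)+edges`) and the tree's 2-sum closure would give
"every graph without two vertex-disjoint cycles is Potts–Rayleigh" (memo `bschramm/prim-bschramm-fk-3/THREE-APEX.md`).

In `K_{1,1,1,n}` (apices `a,b,c`, leaves `u_i` joined to all three, triangle `ab, ac, bc`) a configuration of the leaves and triangle edges
induces a partition of `{a,b,c}` in the five-element lattice `Π₃ = {a|b|c, ab|c, ac|b, bc|a, abc}`; the cluster count is `|π| + #isolated
leaves`, and appending one more leaf (edge probabilities `a,b,c`) or one more triangle edge acts LINEARLY on the vector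
`Z = (Z_0, Z_ab, Z_ac, Z_bc, Z_1)` of masses of the five fibres (`ThreeApex.conv`, the convolution of the join-semilattice `(Π₃, ∨)`).
`ThreeApex.InK q` is the set of vectors reachable from `δ_0 = (1,0,0,0,0)`.  This file proves, for every `Z ∈ InK q`, `0 ≤ q ≤ 1`:
* **`InK.masterN_nonneg`** — `N^{(ac)}(Z) := Z_ac (qZ_0 + Z_ab + Z_ac + Z_bc + Z_1) + (1-q)(Z_ab Z_bc − Z_0 Z_1) ≥ 0`, via the exact identity
  `masterN_conv` (`N(M(z)Z) = (z_0+z_ab)(z_0+z_bc)·N(Z) +` a form with non-negative coefficients) — for the random-cluster measure this is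
  negative correlation of the two triangle edges `ab, bc` in `K_{1,1,1,n}` for EVERY `n` and all weights (the bridge is layer 2);
  the `S₃`-images (`swapBC`, `swapAB`) give `N^{(ab)}, N^{(bc)}`;
* **`InK.lam_nonneg`** — the lower envelope `Z_0 Z_1 ≥ Z_ab Z_ac + Z_ab Z_bc + Z_ac Z_bc` (identity `lam_conv`);
* `t1_decomp` — the Rayleigh difference of the two edges `u a, u b` at one leaf (coefficient table computed exactly, memo §4) equals
  `q²(1−q)c²·N^{(ab)} +` a non-negative form, hence (`t1Form_nonneg`) is `≥ 0` on `InK q`.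
[cite: Grimmett2006, §3.9 eq. (3.94) (pp. 63–64)] [cite: Wagner2006, Thm. 5.8(d), Ex. 5.2 (pp. 13–15)] [folklore]
-/

noncomputable section

namespace Summit.CriticalPhenomena.PercolationContinuityZ3.Theorems

namespace FK

namespace ThreeApex

/-- A vector of masses indexed by the partition lattice `Π₃ = {a|b|c, ab|c, ac|b, bc|a, abc}` of the three apices. [folklore] -/
@[ext] structure V5 where
  /-- mass of `a|b|c` -/
  z0 : ℝ
  /-- mass of `ab|c` -/
  zab : ℝ
  /-- mass of `ac|b` -/
  zac : ℝ
  /-- mass of `bc|a` -/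
  zbc : ℝ
  /-- mass of `abc` -/
  z1 : ℝ

namespace V5

/-- Total mass. [folklore] -/
def total (Z : V5) : ℝ := Z.z0 + Z.zab + Z.zac + Z.zbc + Z.z1

/-- All five masses are non-negative. [folklore] -/
structure Nonneg (Z : V5) : Prop where
  /-- `0 ≤ Z_0` -/
  h0 : 0 ≤ Z.z0
  /-- `0 ≤ Z_ab` -/
  hab : 0 ≤ Z.zab
  /-- `0 ≤ Z_ac` -/
  hac : 0 ≤ Z.zac
  /-- `0 ≤ Z_bc` -/
  hbc : 0 ≤ Z.zbc
  /-- `0 ≤ Z_1` -/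
  h1 : 0 ≤ Z.z1

end V5

/-- The empty product: everything in the fibre `a|b|c`. [folklore] -/
def delta0 : V5 := ⟨1, 0, 0, 0, 0⟩

/-- Appending a letter `z` (a leaf or a triangle edge, itself written as a five-vector) to a product with fibre masses `Z`:
the convolution of the join-semilattice `(Π₃, ∨)` (`0̂ ∨ π = π`, two distinct two-block partitions join to `abc`). [folklore] -/
def conv (z Z : V5) : V5 :=
  ⟨z.z0 * Z.z0,
   z.zab * Z.z0 + (z.z0 + z.zab) * Z.zab,
   z.zac * Z.z0 + (z.z0 + z.zac) * Z.zac,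
   z.zbc * Z.z0 + (z.z0 + z.zbc) * Z.zbc,
   z.total * Z.z1 + z.z1 * (Z.z0 + Z.zab + Z.zac + Z.zbc)
     + (z.zac + z.zbc) * Z.zab + (z.zab + z.zbc) * Z.zac + (z.zab + z.zac) * Z.zbc⟩

/-- The letter of a leaf joined to `a, b, c` with probabilities `a, b, c` under cluster weight `q`: attachment set `A ⊆ {a,b,c}` with product
weight, an extra factor `q` when `A = ∅` (the leaf is then its own cluster), sorted by the block it creates. [folklore] -/
def leaf (q a b c : ℝ) : V5 :=
  ⟨q * (1 - a) * (1 - b) * (1 - c) + a * (1 - b) * (1 - c) + (1 - a) * b * (1 - c) + (1 - a) * (1 - b) * c,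
   a * b * (1 - c), a * (1 - b) * c, (1 - a) * b * c, a * b * c⟩

/-- The letter of the triangle edge `ab` with probability `w`. [folklore] -/
def edgeAB (w : ℝ) : V5 := ⟨1 - w, w, 0, 0, 0⟩

/-- The letter of the triangle edge `ac` with probability `w`. [folklore] -/
def edgeAC (w : ℝ) : V5 := ⟨1 - w, 0, w, 0, 0⟩

/-- The letter of the triangle edge `bc` with probability `w`. [folklore] -/
def edgeBC (w : ℝ) : V5 := ⟨1 - w, 0, 0, w, 0⟩

/-- The MASTER FORM with middle block `ac`: `N^{(ac)}(Z) = Z_ac(qZ_0+Z_ab+Z_ac+Z_bc+Z_1) + (1-q)(Z_ab Z_bc − Z_0 Z_1)`.  For the random-cluster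
measure on `K_{1,1,1,n}` the Rayleigh difference of the triangle edges `ab, bc` is `q²(1-q)·N^{(ac)}(Z)` (memo §2). [folklore] -/
def masterN (q : ℝ) (Z : V5) : ℝ :=
  Z.zac * (q * Z.z0 + Z.zab + Z.zac + Z.zbc + Z.z1) + (1 - q) * (Z.zab * Z.zbc - Z.z0 * Z.z1)

/-- The LOWER-ENVELOPE form `Λ(Z) = Z_0 Z_1 − (Z_ab Z_ac + Z_ab Z_bc + Z_ac Z_bc)`. [folklore] -/
def lam (Z : V5) : ℝ := Z.z0 * Z.z1 - (Z.zab * Z.zac + Z.zab * Z.zbc + Z.zac * Z.zbc)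

/-- The auxiliary letter quantity `κ(z) = z_0 z_ac + z_0 z_1 − z_ab z_bc` of the master identity. [folklore] -/
def kap (z : V5) : ℝ := z.z0 * z.zac + z.z0 * z.z1 - z.zab * z.zbc

/-- Relabelling `b ↔ c` (blocks `ab ↔ ac`). [folklore] -/
def swapBC (Z : V5) : V5 := ⟨Z.z0, Z.zac, Z.zab, Z.zbc, Z.z1⟩

/-- Relabelling `a ↔ b` (blocks `ac ↔ bc`). [folklore] -/
def swapAB (Z : V5) : V5 := ⟨Z.z0, Z.zab, Z.zbc, Z.zac, Z.z1⟩

/-- Admissible letters for cluster weight `q`: leaves with probabilities in `[0,1]` and the three triangle edges. [folklore] -/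
inductive IsLetter (q : ℝ) : V5 → Prop
  | leaf {a b c : ℝ} : 0 ≤ a → a ≤ 1 → 0 ≤ b → b ≤ 1 → 0 ≤ c → c ≤ 1 → IsLetter q (leaf q a b c)
  | ab {w : ℝ} : 0 ≤ w → w ≤ 1 → IsLetter q (edgeAB w)
  | ac {w : ℝ} : 0 ≤ w → w ≤ 1 → IsLetter q (edgeAC w)
  | bc {w : ℝ} : 0 ≤ w → w ≤ 1 → IsLetter q (edgeBC w)

/-- The three-apex monoid: fibre-mass vectors of all finite products of letters. [folklore] -/
inductive InK (q : ℝ) : V5 → Prop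
  | base : InK q delta0
  | step {z Z : V5} : IsLetter q z → InK q Z → InK q (conv z Z)

/-! ### Exact identities -/

/-- **Master identity.** For all `z, Z`: `N(M(z)Z) = (z_0+z_ab)(z_0+z_bc)·N(Z) + N(z)·(Z_0²+Z_0Z_ab+Z_0Z_bc+Z_0Z_1) + (2 z_ac |z| + q κ(z))·Z_0Z_ac
+ (z_ac |z| + κ(z))·Z_ac(Z_ab+Z_ac+Z_bc+Z_1)`. [folklore] -/
theorem masterN_conv (q : ℝ) (z Z : V5) :
    masterN q (conv z Z) = (z.z0 + z.zab) * (z.z0 + z.zbc) * masterN q Z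
      + masterN q z * (Z.z0 ^ 2 + Z.z0 * Z.zab + Z.z0 * Z.zbc + Z.z0 * Z.z1)
      + (2 * z.zac * z.total + q * kap z) * (Z.z0 * Z.zac)
      + (z.zac * z.total + kap z) * (Z.zac * (Z.zab + Z.zac + Z.zbc + Z.z1)) := by
  simp only [masterN, conv, kap, V5.total]
  ring

/-- **Lower-envelope identity.** For all `z, Z`: `Λ(M(z)Z) = Λ(Z)·z_0|z| + Λ(z)·(Z_0²+Z_0ΣZ_x+ΣZ_xZ_y) +` mixed triple and quadruple products. [folklore] -/
theorem lam_conv (z Z : V5) :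
    lam (conv z Z) = lam Z * (z.z0 * z.total)
      + lam z * (Z.z0 ^ 2 + Z.z0 * (Z.zab + Z.zac + Z.zbc) + (Z.zab * Z.zac + Z.zab * Z.zbc + Z.zac * Z.zbc))
      + z.z0 * (Z.zab * Z.zac * z.zbc + Z.zab * Z.zbc * z.zac + Z.zac * Z.zbc * z.zab)
      + Z.z0 * (z.zab * z.zac * Z.zbc + z.zab * z.zbc * Z.zac + z.zac * z.zbc * Z.zab)
      + (Z.zab * Z.zac * (z.zab * z.zbc + z.zac * z.zbc) + Z.zab * Z.zbc * (z.zab * z.zac + z.zac * z.zbc)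
          + Z.zac * Z.zbc * (z.zab * z.zac + z.zab * z.zbc)) := by
  simp only [lam, conv, V5.total]
  ring

/-- The master form of the `b ↔ c` relabelling is the middle-block-`ab` form `Z_ab(qZ_0+ΣZ_x+Z_1) + (1-q)(Z_ac Z_bc − Z_0 Z_1)`. [folklore] -/
theorem masterN_swapBC (q : ℝ) (Z : V5) :
    masterN q (swapBC Z) = Z.zab * (q * Z.z0 + Z.zab + Z.zac + Z.zbc + Z.z1) + (1 - q) * (Z.zac * Z.zbc - Z.z0 * Z.z1) := by
  simp only [masterN, swapBC]; ring

/-- The master form of the `a ↔ b` relabelling is the middle-block-`bc` form `Z_bc(qZ_0+ΣZ_x+Z_1) + (1-q)(Z_ab Z_ac − Z_0 Z_1)`. [folklore] -/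
theorem masterN_swapAB (q : ℝ) (Z : V5) :
    masterN q (swapAB Z) = Z.zbc * (q * Z.z0 + Z.zab + Z.zac + Z.zbc + Z.z1) + (1 - q) * (Z.zab * Z.zac - Z.z0 * Z.z1) := by
  simp only [masterN, swapAB]; ring

/-- Relabelling commutes with the letter action (`b ↔ c`). [folklore] -/
theorem swapBC_conv (z Z : V5) : swapBC (conv z Z) = conv (swapBC z) (swapBC Z) := by
  ext <;> simp only [swapBC, conv, V5.total]
  ring

/-- Relabelling commutes with the letter action (`a ↔ b`). [folklore] -/
theorem swapAB_conv (z Z : V5) : swapAB (conv z Z) = conv (swapAB z) (swapAB Z) := by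
  ext <;> simp only [swapAB, conv, V5.total]
  ring

/-- `b ↔ c` permutes the letters: leaves swap their last two probabilities, `ab ↔ ac`, `bc` is fixed. [folklore] -/
theorem IsLetter.swapBC {q : ℝ} {z : V5} (h : IsLetter q z) : IsLetter q (ThreeApex.swapBC z) := by
  rcases h with ⟨ha0, ha1, hb0, hb1, hc0, hc1⟩ | ⟨hw0, hw1⟩ | ⟨hw0, hw1⟩ | ⟨hw0, hw1⟩
  · rename_i a b c
    have e : ThreeApex.swapBC (ThreeApex.leaf q a b c) = ThreeApex.leaf q a c b := by
      ext <;> simp only [ThreeApex.swapBC, ThreeApex.leaf] <;> ring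
    rw [e]; exact IsLetter.leaf ha0 ha1 hc0 hc1 hb0 hb1
  · rename_i w
    have e : ThreeApex.swapBC (ThreeApex.edgeAB w) = ThreeApex.edgeAC w := by
      ext <;> simp [ThreeApex.swapBC, ThreeApex.edgeAB, ThreeApex.edgeAC]
    rw [e]; exact IsLetter.ac hw0 hw1
  · rename_i w
    have e : ThreeApex.swapBC (ThreeApex.edgeAC w) = ThreeApex.edgeAB w := by
      ext <;> simp [ThreeApex.swapBC, ThreeApex.edgeAB, ThreeApex.edgeAC]
    rw [e]; exact IsLetter.ab hw0 hw1
  · rename_i w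
    have e : ThreeApex.swapBC (ThreeApex.edgeBC w) = ThreeApex.edgeBC w := by
      ext <;> simp [ThreeApex.swapBC, ThreeApex.edgeBC]
    rw [e]; exact IsLetter.bc hw0 hw1

/-- `a ↔ b` permutes the letters: leaves swap their first two probabilities, `ac ↔ bc`, `ab` is fixed. [folklore] -/
theorem IsLetter.swapAB {q : ℝ} {z : V5} (h : IsLetter q z) : IsLetter q (ThreeApex.swapAB z) := by
  rcases h with ⟨ha0, ha1, hb0, hb1, hc0, hc1⟩ | ⟨hw0, hw1⟩ | ⟨hw0, hw1⟩ | ⟨hw0, hw1⟩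
  · rename_i a b c
    have e : ThreeApex.swapAB (ThreeApex.leaf q a b c) = ThreeApex.leaf q b a c := by
      ext <;> simp only [ThreeApex.swapAB, ThreeApex.leaf] <;> ring
    rw [e]; exact IsLetter.leaf hb0 hb1 ha0 ha1 hc0 hc1
  · rename_i w
    have e : ThreeApex.swapAB (ThreeApex.edgeAB w) = ThreeApex.edgeAB w := by
      ext <;> simp [ThreeApex.swapAB, ThreeApex.edgeAB]
    rw [e]; exact IsLetter.ab hw0 hw1
  · rename_i w
    have e : ThreeApex.swapAB (ThreeApex.edgeAC w) = ThreeApex.edgeBC w := by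
      ext <;> simp [ThreeApex.swapAB, ThreeApex.edgeAC, ThreeApex.edgeBC]
    rw [e]; exact IsLetter.bc hw0 hw1
  · rename_i w
    have e : ThreeApex.swapAB (ThreeApex.edgeBC w) = ThreeApex.edgeAC w := by
      ext <;> simp [ThreeApex.swapAB, ThreeApex.edgeAC, ThreeApex.edgeBC]
    rw [e]; exact IsLetter.ac hw0 hw1

/-- The monoid is invariant under `b ↔ c`. [folklore] -/
theorem InK.swapBC {q : ℝ} {Z : V5} (h : InK q Z) : InK q (ThreeApex.swapBC Z) := by
  induction h with
  | base =>
    have e : ThreeApex.swapBC ThreeApex.delta0 = ThreeApex.delta0 := by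
      ext <;> simp [ThreeApex.swapBC, ThreeApex.delta0]
    rw [e]; exact InK.base
  | step hz _ ih => rw [swapBC_conv]; exact InK.step hz.swapBC ih

/-- The monoid is invariant under `a ↔ b`. [folklore] -/
theorem InK.swapAB {q : ℝ} {Z : V5} (h : InK q Z) : InK q (ThreeApex.swapAB Z) := by
  induction h with
  | base =>
    have e : ThreeApex.swapAB ThreeApex.delta0 = ThreeApex.delta0 := by
      ext <;> simp [ThreeApex.swapAB, ThreeApex.delta0]
    rw [e]; exact InK.base
  | step hz _ ih => rw [swapAB_conv]; exact InK.step hz.swapAB ih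

/-! ### Letter lemmas (`0 ≤ q ≤ 1`) -/

/-- Letters have non-negative masses (`0 ≤ q`). [folklore] -/
theorem IsLetter.nonneg {q : ℝ} (hq0 : 0 ≤ q) {z : V5} (h : IsLetter q z) : z.Nonneg := by
  rcases h with ⟨ha0, ha1, hb0, hb1, hc0, hc1⟩ | ⟨hw0, hw1⟩ | ⟨hw0, hw1⟩ | ⟨hw0, hw1⟩
  · rename_i a b c
    have ha' : (0 : ℝ) ≤ 1 - a := sub_nonneg.2 ha1
    have hb' : (0 : ℝ) ≤ 1 - b := sub_nonneg.2 hb1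
    have hc' : (0 : ℝ) ≤ 1 - c := sub_nonneg.2 hc1
    exact ⟨by simp only [ThreeApex.leaf]; positivity, by simp only [ThreeApex.leaf]; positivity,
      by simp only [ThreeApex.leaf]; positivity, by simp only [ThreeApex.leaf]; positivity, by simp only [ThreeApex.leaf]; positivity⟩
  · rename_i w
    have hw' : (0 : ℝ) ≤ 1 - w := sub_nonneg.2 hw1
    exact ⟨by simpa [ThreeApex.edgeAB] using hw', by simpa [ThreeApex.edgeAB] using hw0, by simp [ThreeApex.edgeAB],
      by simp [ThreeApex.edgeAB], by simp [ThreeApex.edgeAB]⟩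
  · rename_i w
    have hw' : (0 : ℝ) ≤ 1 - w := sub_nonneg.2 hw1
    exact ⟨by simpa [ThreeApex.edgeAC] using hw', by simp [ThreeApex.edgeAC], by simpa [ThreeApex.edgeAC] using hw0,
      by simp [ThreeApex.edgeAC], by simp [ThreeApex.edgeAC]⟩
  · rename_i w
    have hw' : (0 : ℝ) ≤ 1 - w := sub_nonneg.2 hw1
    exact ⟨by simpa [ThreeApex.edgeBC] using hw', by simp [ThreeApex.edgeBC], by simp [ThreeApex.edgeBC],
      by simpa [ThreeApex.edgeBC] using hw0, by simp [ThreeApex.edgeBC]⟩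

/-- Total mass of a letter is non-negative. [folklore] -/
theorem V5.Nonneg.total {z : V5} (h : z.Nonneg) : 0 ≤ z.total := by
  obtain ⟨h0, h1, h2, h3, h4⟩ := h; simp only [V5.total]; positivity

/-- The master form of a single letter is `≥ 0`: for a leaf it FACTORS as `a·c·(1−b)·((1−q)a+q)·((1−q)c+q)` (negative correlation of
`ab, bc` on `K₄`), for the edge `ac` it is `w(q(1−w)+w)`, for the edges `ab`, `bc` it vanishes. [folklore] -/
theorem IsLetter.masterN_nonneg {q : ℝ} (hq0 : 0 ≤ q) (hq1 : q ≤ 1) {z : V5} (h : IsLetter q z) : 0 ≤ masterN q z := by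
  have hq' : (0 : ℝ) ≤ 1 - q := sub_nonneg.2 hq1
  rcases h with ⟨ha0, ha1, hb0, hb1, hc0, hc1⟩ | ⟨hw0, hw1⟩ | ⟨hw0, hw1⟩ | ⟨hw0, hw1⟩
  · rename_i a b c
    have e : masterN q (ThreeApex.leaf q a b c) = a * c * (1 - b) * ((1 - q) * a + q) * ((1 - q) * c + q) := by
      simp only [masterN, ThreeApex.leaf]; ring
    rw [e]
    have hb' : (0 : ℝ) ≤ 1 - b := sub_nonneg.2 hb1
    positivity
  · simp [masterN, ThreeApex.edgeAB]
  · rename_i w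
    have hw' : (0 : ℝ) ≤ 1 - w := sub_nonneg.2 hw1
    have e : masterN q (ThreeApex.edgeAC w) = w * (q * (1 - w) + w) := by simp only [masterN, ThreeApex.edgeAC]; ring
    rw [e]; positivity
  · simp [masterN, ThreeApex.edgeBC]

/-- `κ(z) ≥ 0` for every letter: for a leaf `κ = z_0 z_ac + abc·(q āb̄c̄ + a b̄ c̄ + ā b̄ c)`. [folklore] -/
theorem IsLetter.kap_nonneg {q : ℝ} (hq0 : 0 ≤ q) {z : V5} (h : IsLetter q z) : 0 ≤ kap z := by
  rcases h with ⟨ha0, ha1, hb0, hb1, hc0, hc1⟩ | ⟨hw0, hw1⟩ | ⟨hw0, hw1⟩ | ⟨hw0, hw1⟩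
  · rename_i a b c
    have ha' : (0 : ℝ) ≤ 1 - a := sub_nonneg.2 ha1
    have hb' : (0 : ℝ) ≤ 1 - b := sub_nonneg.2 hb1
    have hc' : (0 : ℝ) ≤ 1 - c := sub_nonneg.2 hc1
    have e : kap (ThreeApex.leaf q a b c) =
        (q * (1 - a) * (1 - b) * (1 - c) + a * (1 - b) * (1 - c) + (1 - a) * b * (1 - c) + (1 - a) * (1 - b) * c)
          * (a * (1 - b) * c)
        + a * b * c * (q * (1 - a) * (1 - b) * (1 - c) + a * (1 - b) * (1 - c) + (1 - a) * (1 - b) * c) := by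
      simp only [kap, ThreeApex.leaf]; ring
    rw [e]; positivity
  · simp [kap, ThreeApex.edgeAB]
  · rename_i w
    have hw' : (0 : ℝ) ≤ 1 - w := sub_nonneg.2 hw1
    have e : kap (ThreeApex.edgeAC w) = (1 - w) * w := by simp only [kap, ThreeApex.edgeAC]; ring
    rw [e]; positivity
  · simp [kap, ThreeApex.edgeBC]

/-- `Λ(z) ≥ 0` for every letter: for a leaf `Λ = q·abc·(1−a)(1−b)(1−c)`, for an edge `Λ = 0`. [folklore] -/
theorem IsLetter.lam_nonneg {q : ℝ} (hq0 : 0 ≤ q) {z : V5} (h : IsLetter q z) : 0 ≤ lam z := by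
  rcases h with ⟨ha0, ha1, hb0, hb1, hc0, hc1⟩ | ⟨hw0, hw1⟩ | ⟨hw0, hw1⟩ | ⟨hw0, hw1⟩
  · rename_i a b c
    have ha' : (0 : ℝ) ≤ 1 - a := sub_nonneg.2 ha1
    have hb' : (0 : ℝ) ≤ 1 - b := sub_nonneg.2 hb1
    have hc' : (0 : ℝ) ≤ 1 - c := sub_nonneg.2 hc1
    have e : lam (ThreeApex.leaf q a b c) = q * (a * b * c) * ((1 - a) * (1 - b) * (1 - c)) := by simp only [lam, ThreeApex.leaf]; ring
    rw [e]; positivity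
  all_goals simp [lam, ThreeApex.edgeAB, ThreeApex.edgeAC, ThreeApex.edgeBC]

/-! ### The monoid: non-negativity, the master inequality, the lower envelope -/

/-- Every vector of the monoid has non-negative masses. [folklore] -/
theorem InK.nonneg {q : ℝ} (hq0 : 0 ≤ q) {Z : V5} (h : InK q Z) : Z.Nonneg := by
  induction h with
  | base => exact ⟨by simp [delta0], by simp [delta0], by simp [delta0], by simp [delta0], by simp [delta0]⟩
  | @step z Z hz _ ih =>
    obtain ⟨h0, h1, h2, h3, h4⟩ := ih
    obtain ⟨g0, g1, g2, g3, g4⟩ := hz.nonneg hq0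
    have gt : 0 ≤ z.total := V5.Nonneg.total ⟨g0, g1, g2, g3, g4⟩
    refine ⟨?_, ?_, ?_, ?_, ?_⟩ <;> simp only [conv] <;> positivity

/-- **THEOREM M (master inequality).** `N^{(ac)}(Z) ≥ 0` for every `Z` in the three-apex monoid, `0 ≤ q ≤ 1`.  (For the random-cluster measure:
the triangle edges `ab` and `bc` of `K_{1,1,1,n}` are negatively correlated for every `n` and all weights — layer 2 supplies the bridge.) [folklore] -/
theorem InK.masterN_nonneg {q : ℝ} (hq0 : 0 ≤ q) (hq1 : q ≤ 1) {Z : V5} (h : InK q Z) : 0 ≤ masterN q Z := by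
  induction h with
  | base => simp [masterN, delta0]
  | @step z Z hz hZ ih =>
    obtain ⟨h0, h1, h2, h3, h4⟩ := hZ.nonneg hq0
    obtain ⟨g0, g1, g2, g3, g4⟩ := hz.nonneg hq0
    have gt : 0 ≤ z.total := V5.Nonneg.total ⟨g0, g1, g2, g3, g4⟩
    have gn : 0 ≤ masterN q z := hz.masterN_nonneg hq0 hq1
    have gk : 0 ≤ kap z := hz.kap_nonneg hq0
    rw [masterN_conv]
    positivity

/-- The master inequality with middle block `ab`: `Z_ab(qZ_0+ΣZ_x+Z_1) + (1-q)(Z_ac Z_bc − Z_0 Z_1) ≥ 0` on the monoid. [folklore] -/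
theorem InK.masterNab_nonneg {q : ℝ} (hq0 : 0 ≤ q) (hq1 : q ≤ 1) {Z : V5} (h : InK q Z) :
    0 ≤ Z.zab * (q * Z.z0 + Z.zab + Z.zac + Z.zbc + Z.z1) + (1 - q) * (Z.zac * Z.zbc - Z.z0 * Z.z1) := by
  rw [← masterN_swapBC]; exact h.swapBC.masterN_nonneg hq0 hq1

/-- The master inequality with middle block `bc`: `Z_bc(qZ_0+ΣZ_x+Z_1) + (1-q)(Z_ab Z_ac − Z_0 Z_1) ≥ 0` on the monoid. [folklore] -/
theorem InK.masterNbc_nonneg {q : ℝ} (hq0 : 0 ≤ q) (hq1 : q ≤ 1) {Z : V5} (h : InK q Z) :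
    0 ≤ Z.zbc * (q * Z.z0 + Z.zab + Z.zac + Z.zbc + Z.z1) + (1 - q) * (Z.zab * Z.zac - Z.z0 * Z.z1) := by
  rw [← masterN_swapAB]; exact h.swapAB.masterN_nonneg hq0 hq1

/-- **THEOREM L (lower envelope).** `Z_0 Z_1 ≥ Z_ab Z_ac + Z_ab Z_bc + Z_ac Z_bc` on the three-apex monoid (`0 ≤ q`); equality is approached by
products of many dilute leaves. [folklore] -/
theorem InK.lam_nonneg {q : ℝ} (hq0 : 0 ≤ q) {Z : V5} (h : InK q Z) : 0 ≤ lam Z := by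
  induction h with
  | base => simp [lam, delta0]
  | @step z Z hz hZ ih =>
    obtain ⟨h0, h1, h2, h3, h4⟩ := hZ.nonneg hq0
    obtain ⟨g0, g1, g2, g3, g4⟩ := hz.nonneg hq0
    have gt : 0 ≤ z.total := V5.Nonneg.total ⟨g0, g1, g2, g3, g4⟩
    have gl : 0 ≤ lam z := hz.lam_nonneg hq0
    rw [lam_conv]
    positivity

/-! ### Type T1: the two edges at one leaf -/

/-- The Rayleigh difference `Z¹⁰Z⁰¹ − Z¹¹Z⁰⁰` of the two edges `u a`, `u b` at one leaf `u` of `K_{1,1,1,n}` (third edge `u c` of probability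
`c`), as a quadratic form in the fibre-mass vector `Z` of all other letters (exact coefficient table, memo THREE-APEX.md §4 / tri39.py). [folklore] -/
def t1Form (q c : ℝ) (Z : V5) : ℝ :=
  (q ^ 3 * c ^ 2 + 2 * q ^ 4 * c - 3 * q ^ 4 * c ^ 2 + q ^ 5 - 4 * q ^ 5 * c + 3 * q ^ 5 * c ^ 2 - q ^ 6 + 2 * q ^ 6 * c - q ^ 6 * c ^ 2)
      * (Z.z0 * Z.zab)
  + (-(q ^ 2 * c ^ 2) + 2 * q ^ 3 * c ^ 2 + q ^ 4 - q ^ 4 * c - q ^ 4 * c ^ 2 - q ^ 5 + q ^ 5 * c) * (Z.z0 * Z.z1)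
  + (q ^ 2 * c ^ 2 + 2 * q ^ 3 * c - 3 * q ^ 3 * c ^ 2 + q ^ 4 - 4 * q ^ 4 * c + 3 * q ^ 4 * c ^ 2 - q ^ 5 + 2 * q ^ 5 * c - q ^ 5 * c ^ 2)
      * (Z.zab ^ 2 + Z.zab * Z.zac + Z.zab * Z.zbc)
  + (2 * q ^ 2 * c - q ^ 2 * c ^ 2 + 2 * q ^ 3 - 5 * q ^ 3 * c + 2 * q ^ 3 * c ^ 2 - 2 * q ^ 4 + 3 * q ^ 4 * c - q ^ 4 * c ^ 2)
      * (Z.zab * Z.z1)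
  + (q ^ 2 * c ^ 2 - 2 * q ^ 3 * c ^ 2 + q ^ 4 * c ^ 2) * (Z.zac * Z.zbc)
  + (q ^ 3 - q ^ 3 * c - q ^ 4 + q ^ 4 * c) * (Z.zac * Z.z1 + Z.zbc * Z.z1)
  + (q ^ 2 - q ^ 2 * c - q ^ 3 + q ^ 3 * c) * Z.z1 ^ 2

/-- **T1 decomposition**: `D₁ = q²(1−q)c²·N^{(ab)}(Z) + R` with `R` a form whose coefficients factor into non-negative pieces on
`0 ≤ q ≤ 1`, `0 ≤ c ≤ 1`. [folklore] -/
theorem t1_decomp (q c : ℝ) (Z : V5) :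
    t1Form q c Z = q ^ 2 * (1 - q) * c ^ 2 * masterN q (swapBC Z)
      + q ^ 4 * (1 - c) * (q * (1 - q) + c * (1 - q) * (2 - q)) * (Z.z0 * Z.zab)
      + q ^ 4 * (1 - q) * (1 - c) * (Z.z0 * Z.z1)
      + q ^ 3 * (1 - c) * (q * (1 - q) + c * (1 - q) * (2 - q)) * (Z.zab ^ 2 + Z.zab * Z.zac + Z.zab * Z.zbc)
      + q ^ 2 * (1 - c) * (2 * q * (1 - q) + c * (1 - q) * (2 - q)) * (Z.zab * Z.z1)
      + q ^ 3 * (1 - q) * (1 - c) * (Z.zac * Z.z1 + Z.zbc * Z.z1)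
      + q ^ 2 * (1 - q) * (1 - c) * Z.z1 ^ 2 := by
  simp only [t1Form, masterN, swapBC]
  ring

/-- **T1 on the monoid**: the leaf form is non-negative for every `Z ∈ InK q`, `0 ≤ q ≤ 1`, `0 ≤ c ≤ 1` — i.e. (after the layer-2 bridge) the two
edges from any leaf to two apices of `K_{1,1,1,n}` are negatively correlated for every `n` and all weights. [folklore] -/
theorem InK.t1Form_nonneg {q c : ℝ} (hq0 : 0 ≤ q) (hq1 : q ≤ 1) (hc0 : 0 ≤ c) (hc1 : c ≤ 1) {Z : V5} (h : InK q Z) :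
    0 ≤ t1Form q c Z := by
  obtain ⟨h0, h1, h2, h3, h4⟩ := h.nonneg hq0
  have hN : 0 ≤ masterN q (ThreeApex.swapBC Z) := h.swapBC.masterN_nonneg hq0 hq1
  have hq' : (0 : ℝ) ≤ 1 - q := sub_nonneg.2 hq1
  have hc' : (0 : ℝ) ≤ 1 - c := sub_nonneg.2 hc1
  have h2q : 0 ≤ 2 - q := by linarith
  rw [t1_decomp]
  positivity

end ThreeApex

end FK

end Summit.CriticalPhenomena.PercolationContinuityZ3.Theorems
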